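import Summits.KontsevichZagierPeriods.KontsevichZagierPeriods.Theses.Neg
import Summits.KontsevichZagierPeriods.KontsevichZagierPeriods.Theses.SelbergAMGM
import Literature.NumberTheory.Transcendental.KZProductIdeal
import Literature.NumberTheory.Transcendental.KZRulesAssociator
import Summits.KontsevichZagierPeriods.KontsevichZagierPeriods.Theorems.MzvKernelInKZ.Negative.Core
import HarnessLib

/-!
# Crux `KernelForm` (stmt-KontsevichZagierPeriods-10447), line `Sketch`: dictionary of the
# geometric half `Cancellation`

`Cancellation := ∀ c s : KZ.FormalRep, KZ.eval s ≠ 0 → s * c ∈ KZ.relations → c ∈ KZ.relations`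
(multipliers of non-zero value are non-zero-divisors of the formal period ring
`P = KZ.FormalRep ⧸ KZ.relations`, `KZ.FormalPeriodRing`) is the geometric half of the cut
`KernelForm ↔ WeakKernel ∧ Cancellation` of the line `Sketch`. This file relates it to the items of
other routes that state the same thing in other clothes (all statements inline, no definitions):

* `piCancellation_of_cancellation` — `Cancellation → KZ.PiCancellation` (route AyoubSpecialisation's
  shape, `s = [π]`);
* `positiveCancellation_of_cancellation` — `Cancellation → SelbergAMGM.PositiveCancellation`
  (stmt-5621: positive cube roots are unique and non-zero-valued classes cancel), a three-line
  computation in the commutative ring `KZ.FormalPeriodRing`;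
* `thinCancellation_of_positiveCancellation` — `SelbergAMGM.PositiveCancellation →` cancellation by
  `1 + [K, κ]` for thin compact volume forms (the registered stub `stub_unitPlusSmallCancellation`
  of the line), via `((1+C)³ − 1)(1+T) = (3 + 3C + C²)(C + TC)`;
* `not_cancellation_of_cancellationGap` — route Neg's crux `CancellationGap` (stmt-11011) refutes
  `Cancellation` (it is its bundled negation).

With the canceller normal form of the line (`cancellation_iff_thinCancellation`, file
`VietaFibreKernelFormCancellerNormalForm.lean`) these close up into equivalences
`Cancellation ↔ ThinCancellation ↔ PositiveCancellation ↔ ¬ CancellationGap`.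

References: M. Kontsevich, D. Zagier, *Periods* (2001), §1.2, §4.1; A. Huber, G. Wüstholz,
*Transcendence and linear relations of 1-periods* (2022), App. A.3–A.4.
-/

noncomputable section

open MeasureTheory Set
open Literature.NumberTheory.Transcendental
open Summit.KontsevichZagierPeriods.KontsevichZagierPeriods.Theses

namespace Summit.KontsevichZagierPeriods.KernelForm.LocaliseAtValuePrime

/-- `Cancellation → PiCancellation`: `[π]` has value `π ≠ 0`. [folklore] -/
theorem piCancellation_of_cancellation
    (hC : ∀ c s : KZ.FormalRep, KZ.eval s ≠ 0 → s * c ∈ KZ.relations → c ∈ KZ.relations) :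
    KZ.PiCancellation := by
  intro c h
  exact hC c _ (by rw [KZ.eval_of_piRep]; exact Real.pi_ne_zero) h

/-- `Cancellation → PositiveCancellation` (stmt-5621): from `x³k ≡ y³k` cancel `k` (value `≠ 0`),
factor `x³ − y³ = (x² + xy + y²)(x − y)` in the commutative ring `KZ.FormalPeriodRing`, and cancel
`x² + xy + y²` (value `a² + ab + b² > 0` for `a = eval x > 0`, `b = eval y > 0`). [folklore] -/
theorem positiveCancellation_of_cancellation
    (hC : ∀ c s : KZ.FormalRep, KZ.eval s ≠ 0 → s * c ∈ KZ.relations → c ∈ KZ.relations) :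
    SelbergAMGM.PositiveCancellation := by
  unfold SelbergAMGM.PositiveCancellation
  intro x y k h hx hy hk
  have h1 : k * (x * x * x - y * y * y) ∈ KZ.relations := by
    rw [← KZ.toFormalPeriod_eq_zero_iff] at h ⊢
    simp only [map_sub, map_mul] at h ⊢
    linear_combination h
  have h2 : x * x * x - y * y * y ∈ KZ.relations := hC _ k hk h1
  have h3 : (x * x + x * y + y * y) * (x - y) ∈ KZ.relations := by
    rw [← KZ.toFormalPeriod_eq_zero_iff] at h2 ⊢
    simp only [map_sub, map_mul, map_add] at h2 ⊢
    linear_combination h2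
  refine hC _ (x * x + x * y + y * y) (ne_of_gt ?_) h3
  rw [map_add, map_add, KZ.eval_mul', KZ.eval_mul', KZ.eval_mul']
  positivity

/-- The value of a class killed by `1 + [K]` with `0 ≤ K.value` vanishes. [folklore] -/
theorem eval_eq_zero_of_add_of_mul_mem {m : ℕ} (K : KZ.IntegralRep m) (hK : 0 ≤ K.value)
    {c : KZ.FormalRep} (h : c + KZ.of K * c ∈ KZ.relations) : KZ.eval c = 0 := by
  have h1 := KZ.relations_le_ker_eval_holds h
  rw [AddMonoidHom.mem_ker, map_add, KZ.eval_mul', KZ.eval_of] at h1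
  have : KZ.eval c * (1 + K.value) = 0 := by linarith [h1]
  rcases mul_eq_zero.mp this with h2 | h2
  · exact h2
  · exfalso; linarith

/-- The value of a representation with constant positive rational integrand is non-negative. [folklore] -/
theorem value_nonneg_of_integrand_eq_const {m : ℕ} (K : KZ.IntegralRep m) {κ : ℚ} (hκ : 0 < κ)
    (hK : ∀ x ∈ K.domain, K.integrand x = κ) : 0 ≤ K.value := by
  rw [KZ.IntegralRep.value]
  refine setIntegral_nonneg (KZ.IntegralRep.measurableSet_domain_holds K) fun x hx => ?_
  rw [hK x hx]; exact_mod_cast hκ.le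

/-- `PositiveCancellation → ThinCancellation` (the line's registered stub
`stub_unitPlusSmallCancellation` follows from stmt-5621): with `C = ⟦c⟧`, `T = ⟦[K, κ]⟧` in
`KZ.FormalPeriodRing` and `C + TC = 0`, the identity `((1+C)³ − 1)(1+T) = (3 + 3C + C²)(C + TC)`
makes `(x, y, k) = (1 + c, 1, 1 + [K, κ])` an instance of positive cancellation, whence `c ≡ 0`.
[folklore] -/
theorem thinCancellation_of_positiveCancellation :
    Summit.KontsevichZagierPeriods.KontsevichZagierPeriods.Theses.SelbergAMGM.PositiveCancellation → ∀ c : KZ.FormalRep, (∀ ε : ℝ, 0 < ε → ∃ (k : ℕ) (K : KZ.IntegralRep (k + 1)) (κ : ℚ), 0 < κ ∧ IsCompact K.domain ∧ (interior K.domain).Nonempty ∧ (∀ x ∈ K.domain, K.integrand x = κ) ∧ KZ.eval (KZ.of K) < ε ∧ c + KZ.of K * c ∈ KZ.relations) → c ∈ KZ.relations := by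
  intro hPC
  unfold SelbergAMGM.PositiveCancellation at hPC
  intro c hc
  obtain ⟨k, K, κ, hκ, -, -, hK1, -, hrel⟩ := hc 1 one_pos
  have hKv : 0 ≤ K.value := value_nonneg_of_integrand_eq_const K hκ hK1
  have hc0 : KZ.eval c = 0 := eval_eq_zero_of_add_of_mul_mem K hKv hrel
  have key := hPC (KZ.of KZ.IntegralRep.unit + c) (KZ.of KZ.IntegralRep.unit)
    (KZ.of KZ.IntegralRep.unit + KZ.of K) ?_ ?_ ?_ ?_
  · simpa using key
  · rw [← KZ.toFormalPeriod_eq_zero_iff] at hrel ⊢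
    simp only [map_sub, map_mul, map_add, KZ.toFormalPeriod_of_unit] at hrel ⊢
    set C := KZ.toFormalPeriod c
    set T := KZ.toFormalPeriod (KZ.of K)
    have : (1 + C) * (1 + C) * (1 + C) * (1 + T) - 1 * 1 * 1 * (1 + T) =
        (3 + 3 * C + C * C) * (C + T * C) := by ring
    rw [this, hrel, mul_zero]
  · rw [map_add, KZ.eval_of, KZ.IntegralRep.value_unit, hc0]; norm_num
  · rw [KZ.eval_of, KZ.IntegralRep.value_unit]; norm_num
  · rw [map_add, KZ.eval_of, KZ.IntegralRep.value_unit, KZ.eval_of]; linarith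

/-- `CancellationGap → ¬ Cancellation` (route Neg's crux stmt-11011 is the bundled negation of the
geometric half): the hand-written product representations `rs`, `r's` of the gap agree, modulo
relations, with the Fubini products `r.prod s`, `r'.prod s` (same domains, integrands equal on
them), so `rs ∼ r's` reads `[s] * ([r] − [r']) ∈ relations` (commutativity modulo relations), and
cancelling `[s]` (value `≠ 0`) would give the excluded `r ∼ r'`. [folklore] -/
theorem not_cancellation_of_cancellationGap (hG : Neg.CancellationGap) :
    ¬ (∀ c s : KZ.FormalRep, KZ.eval s ≠ 0 → s * c ∈ KZ.relations → c ∈ KZ.relations) := by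
  intro hC
  obtain ⟨n, m, k, r, r', s, rs, r's, hrsd, hrsi, hr'sd, hr'si, hsv, hE, hnE⟩ := hG
  apply hnE
  have e1 : KZ.of rs - KZ.of (r.prod s) ∈ KZ.relations := by
    refine Summit.KontsevichZagierPeriods.MzvKernelInKZ.Negative.of_sub_of_mem_relations_of_eqOn ?_ ?_
    · rw [hrsd]; rfl
    · intro z hz
      rw [hrsi hz, KZ.IntegralRep.prod_integrand_eq, KZ.IntegralRep.prodFun_apply]
  have e2 : KZ.of r's - KZ.of (r'.prod s) ∈ KZ.relations := by
    refine Summit.KontsevichZagierPeriods.MzvKernelInKZ.Negative.of_sub_of_mem_relations_of_eqOn ?_ ?_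
    · rw [hr'sd]; rfl
    · intro z hz
      rw [hr'si hz, KZ.IntegralRep.prod_integrand_eq, KZ.IntegralRep.prodFun_apply]
  have h1 : (KZ.of r - KZ.of r') * KZ.of s ∈ KZ.relations := by
    rw [sub_mul, KZ.of_mul_of, KZ.of_mul_of]
    have : KZ.of (r.prod s) - KZ.of (r'.prod s) =
        (KZ.of rs - KZ.of r's) - (KZ.of rs - KZ.of (r.prod s)) + (KZ.of r's - KZ.of (r'.prod s)) := by abel
    rw [this]
    exact KZ.relations.add_mem (KZ.relations.sub_mem hE e1) e2
  exact hC _ (KZ.of s) (by rwa [KZ.eval_of]) (KZ.mul_mem_relations_of_left h1)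

end Summit.KontsevichZagierPeriods.KernelForm.LocaliseAtValuePrime
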